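import Mathlib
import HarnessLib
import Summits.CriticalPhenomena.CardyFormulaZ2.Theses.CardySelfRefinement
import Literature.Probability.RandomPlanarGeometry.ChordalReversibility
import Literature.Probability.RandomPlanarGeometry.ConformalRectangle
import Literature.Probability.RandomPlanarGeometry.IsometryCovariance
import Literature.Probability.LatticeModels.DiscreteFaceBoundary
import Literature.Probability.Percolation.PlanarDuality

/-!
# The boundary cycle of admissible square-lattice Dobrushin data: labels, wiring, out-darts
(helper for L1 `touchExponent_sepDictionary` of stub `stub_touchExponent`, line `SketchIdeatorTwo`,
crux `SymmetryUpgradeR`, stmt-CriticalPhenomena-17239)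

Configuration-free facts about the left-hand boundary cycle `bwalk (startCorner hE)` of
`DiscreteFaceBoundary.lean` (the boundary of the union of inner faces, from the `A`-end of `e_a`
across `e_a`) needed by the discrete "interface = outer boundary of the wired cluster" dictionary:

* `sepDict_W_eq_of_inner`, `sepDict_exists_bwalk_eq` — the winding number of the cycle does not
  jump between two inner faces; an out-dart whose inner face has winding number one lies on the
  cycle (regular domain);
* `sepDict_exists_isOutEdge_of_zdBoundary` — a boundary site on an inner face sources an out-dart;
* `sepDict_no_transition`, `sepDict_mem_zdArcB_of_le`, `sepDict_mem_zdArcA_of_lt` — along the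
  cycle the labels change only at `e_a` and `e_b` (there are exactly two `A`–`B` edges): the sites
  at positions `1 ≤ s ≤ t_b` (up to the end dart `e_b`) are `B`-sites, those at `t_b < s ≤ P` are
  `A`-sites WIRED to the `A`-end of `e_a` (`touchExponent_sepDictionary_cycle`, registered);
* `sepDict_not_AB_of_no_innerFace` — an edge of `Ω_δ` bordering no inner face is not an `A`–`B`
  edge;
* `sepDict_cSrc_cornerOrbit_ne_start`, `sepDict_cSrc_ne_cTgt_of_inner` — the exploration visits
  `e_a` only at its start; an edge between two inner faces is not a face-boundary edge.

References: S. Smirnov, C. R. Acad. Sci. Paris 333 (2001), §2; CDHKS, C. R. Math. 352 (2014), §2.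
-/

noncomputable section

namespace Summit.CriticalPhenomena.CardyFormulaZ2.Theorems.SymmetryUpgradeR.SwallowingSkeleton

open MeasureTheory Filter Set
open Literature.Probability.RandomPlanarGeometry Literature.Probability.LatticeModels
  Literature.Probability.Percolation
open UpperHalfPlane (upperHalfPlaneSet)
open SimpleGraph DiscreteDobrushin

variable {E : DiscreteDobrushin}

/-! ### Winding numbers of the boundary cycle: no jump between inner faces; out-darts whose
inner face has winding number one lie on the cycle -/

/-- **No jump between two inner faces.** The boundary cycle from `e_a` never runs along an edge
both of whose faces are inner, so the winding numbers of the `k`-th and the `(k+3)`-rd face around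
a vertex agree when both are inner. -/
theorem sepDict_W_eq_of_inner (hE : E.IsZdAdmissible) {x : Site 2} {k : Fin 4}
    (h1 : E.IsInnerFace (faceAt x k)) (h2 : E.IsInnerFace (faceAt x (k + 3))) :
    (bcycle hE).W (toZ2 (faceAt x k)) = (bcycle hE).W (toZ2 (faceAt x (k + 3))) := by
  refine W_bloop_eq_of_forall_ne (i := 0) (m := bperiod hE (isOutEdge_startCorner hE))
    (hm := bperiod_pos _ _) (hcl := by rw [zero_add, bwalk_bperiod]; rfl) (d₀ := startCorner hE)
    (x := x) (k := k) ?_ ?_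
  · intro t _ heq
    rw [zero_add] at heq
    have := isOutEdge_bwalk (isOutEdge_startCorner hE) t
    rw [heq] at this
    exact this.2 h2
  · intro t _ heq
    rw [zero_add] at heq
    have := isOutEdge_bwalk (isOutEdge_startCorner hE) t
    rw [heq] at this
    have h3 := (isOutEdge_iff_isInEdge _ _).1 this
    rw [add_cornerUnit_add_cornerUnit_add_two, fin4_add_two_add_two'] at h3
    exact h3.2 h1

/-- **An out-dart whose inner face has winding number one lies on the boundary cycle from `e_a`**
(regular domain): its outer face has winding number zero, so the cycle must pass along it. -/
theorem sepDict_exists_bwalk_eq (J : JordanDomain) (hΩ : E.Ω = J.carrier) (hE : E.IsZdAdmissible)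
    {x : Site 2} {k : Fin 4} (hout : E.IsOutEdge x k) (hW : (bcycle hE).W (toZ2 (faceAt x k)) = 1) :
    ∃ s < bperiod hE (isOutEdge_startCorner hE), E.bwalk (startCorner hE) s = (x, k) := by
  have hreg := regular_of_eq_carrier (D := E) J hΩ
  by_contra h
  simp only [not_exists, not_and] at h
  have h' : ∀ t, E.bwalk (startCorner hE) t ≠ (x, k) := fun t ht =>
    h (t % bperiod hE (isOutEdge_startCorner hE)) (Nat.mod_lt _ (bperiod_pos _ _))
      (by rw [bwalk_mod_bperiod]; exact ht)
  have hW0 : (bcycle hE).W (toZ2 (faceAt x (k + 3))) = 0 :=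
    W_bloop_eq_zero_of_not_isInnerFace hE.delta_pos (isOutEdge_startCorner hE) hreg.1 hreg.2.1
      hreg.2.2.1 hreg.2.2.2 hout.2 (isCorner_faceAt _ _) hout.fst_mem_meshDomain
  have key := W_bloop_eq_of_forall_ne (i := 0) (m := bperiod hE (isOutEdge_startCorner hE))
    (hm := bperiod_pos _ _) (hcl := by rw [zero_add, bwalk_bperiod]; rfl) (d₀ := startCorner hE)
    (x := x) (k := k) (fun t _ => by rw [zero_add]; exact h' t)
    (fun t _ => by rw [zero_add]; exact bwalk_ne_reverse (isOutEdge_startCorner hE) hout t)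
  change (bcycle hE).W (toZ2 (faceAt x k)) = (bcycle hE).W (toZ2 (faceAt x (k + 3))) at key
  rw [hW, hW0] at key
  exact one_ne_zero key

/-- Around a vertex with an inner face and a non-inner face some edge is sourced: a face-boundary
dart out of the vertex (cyclic `0/1` bookkeeping on `Fin 4`). -/
theorem sepDict_exists_isOutEdge {x : Site 2} {i j : Fin 4} (hi : E.IsInnerFace (faceAt x i))
    (hj : ¬ E.IsInnerFace (faceAt x j)) : ∃ k, E.IsOutEdge x k := by
  classical
  have key : ∀ b : Fin 4 → Bool, ∀ i j : Fin 4, b i = true → b j = false →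
      ∃ k, b k = true ∧ b (k + 3) = false := by decide
  obtain ⟨k, hk1, hk2⟩ := key (fun k => decide (E.IsInnerFace (faceAt x k))) i j
    (by simpa using hi) (by simpa using hj)
  exact ⟨k, of_decide_eq_true hk1, of_decide_eq_false hk2⟩

/-- A vertex that is a corner of an inner face and of a non-inner face sources a face-boundary
dart. -/
theorem sepDict_exists_isOutEdge_of_corner {x F F' : Site 2} (hF : IsCorner x F)
    (hin : E.IsInnerFace F) (hF' : IsCorner x F') (hout : ¬ E.IsInnerFace F') :
    ∃ k, E.IsOutEdge x k := by
  obtain ⟨i, rfl⟩ := exists_faceAt_of_isCorner hF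
  obtain ⟨j, rfl⟩ := exists_faceAt_of_isCorner hF'
  exact sepDict_exists_isOutEdge hin hout

/-- **A boundary site on an inner face sources a face-boundary dart**: a site of the square-lattice
discrete boundary `zdBoundary` is a corner of a non-inner face. -/
theorem sepDict_exists_isOutEdge_of_zdBoundary {x F : Site 2} (hx : x ∈ E.zdBoundary)
    (hF : IsCorner x F) (hin : E.IsInnerFace F) : ∃ k, E.IsOutEdge x k := by
  rcases hx with hx | ⟨y, -, -, g, hg, hxg, -⟩
  · -- a lattice neighbour not joined in `Ω_δ`: the two faces of that edge are not inner
    obtain ⟨-, y, hxy, hny⟩ := hx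
    obtain ⟨k, rfl⟩ := exists_eq_add_cornerUnit hxy
    refine sepDict_exists_isOutEdge_of_corner hF hin (isCorner_faceAt x k) fun h => hny ?_
    exact adj_of_isInnerFace_faceAt h (Or.inl rfl)
  · exact sepDict_exists_isOutEdge_of_corner hF hin hxg hg


/-! ### Labels along the boundary cycle: `B`-sites up to `e_b`, `A`-sites after `e_b` -/

/-- The edge of a dart of the boundary cycle from `e_a` at a position `0 < s < P` is not `e_a`. -/
theorem sepDict_cSrc_bwalk_ne_start (hE : E.IsZdAdmissible) {s : ℕ} (hs0 : 0 < s)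
    (hsP : s < bperiod hE (isOutEdge_startCorner hE)) :
    cSrc (E.bwalk (startCorner hE) s) ≠ cSrc (startCorner hE) := by
  intro h
  have h0 := eq_of_isOutEdge_of_cSrc_eq (isOutEdge_bwalk (isOutEdge_startCorner hE) s)
    (isOutEdge_startCorner hE) h
  have := bwalk_injOn hE (isOutEdge_startCorner hE) (i := s) (j := 0) hsP (bperiod_pos _ _)
    (by rw [h0]; rfl)
  omega

/-- **An `A`–`B` transition along the boundary cycle happens only at `e_a` or at `e_b`.** If the
dart at position `s` (`0 < s < P`, `s ≠ t_b` where the end dart sits at `t_b`) joins sites on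
different arcs, contradiction. -/
theorem sepDict_no_transition (hE : E.IsZdAdmissible) {tb : ℕ}
    (htbP : tb < bperiod hE (isOutEdge_startCorner hE))
    (htbeq : E.bwalk (startCorner hE) tb = ebDart hE) {s : ℕ} (hs0 : 0 < s)
    (hsP : s < bperiod hE (isOutEdge_startCorner hE)) (hstb : s ≠ tb)
    (hAB : ((E.bwalk (startCorner hE) s).1 ∈ E.zdArcA ∧ (E.bwalk (startCorner hE) (s + 1)).1 ∈ E.zdArcB) ∨
      ((E.bwalk (startCorner hE) s).1 ∈ E.zdArcB ∧ (E.bwalk (startCorner hE) (s + 1)).1 ∈ E.zdArcA)) :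
    False := by
  have hout := isOutEdge_bwalk (isOutEdge_startCorner hE) s
  have hmem : cSrc (E.bwalk (startCorner hE) s) ∈ E.zdABEdges := by
    rw [mem_zdABEdges_iff]
    refine ⟨hout.isFaceBoundaryEdge.1, ?_, ?_⟩
    · rcases hAB with ⟨hA, -⟩ | ⟨-, hA⟩
      · exact ⟨_, Sym2.mem_mk_left _ _, hA⟩
      · exact ⟨_, Sym2.mem_mk_right _ _, by rwa [← bwalk_fst_succ]⟩
    · rcases hAB with ⟨-, hB⟩ | ⟨hB, -⟩
      · exact ⟨_, Sym2.mem_mk_right _ _, by rwa [← bwalk_fst_succ]⟩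
      · exact ⟨_, Sym2.mem_mk_left _ _, hB⟩
  have heq := eq_of_mem_zdABEdges_of_ne hE hmem (cSrc_ebDart'_mem hE ∅)
    (sepDict_cSrc_bwalk_ne_start hE hs0 hsP) (cSrc_ebDart'_ne hE ∅)
  have h0 := eq_of_isOutEdge_of_cSrc_eq hout (isOutEdge_ebDart hE) heq
  rw [← htbeq] at h0
  exact hstb (bwalk_injOn hE (isOutEdge_startCorner hE) hsP htbP h0)

/-- **The `B`-stretch.** The vertices of the boundary cycle from `e_a` at the positions
`1 ≤ s ≤ t_b` (up to the `B`-end of `e_b`) lie on the arc `B`. -/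
theorem sepDict_mem_zdArcB_of_le (hE : E.IsZdAdmissible) {tb : ℕ}
    (htbP : tb < bperiod hE (isOutEdge_startCorner hE))
    (htbeq : E.bwalk (startCorner hE) tb = ebDart hE) :
    ∀ s, 1 ≤ s → s ≤ tb → (E.bwalk (startCorner hE) s).1 ∈ E.zdArcB := by
  intro s hs1 hstb
  induction s with
  | zero => omega
  | succ s ih =>
    rcases Nat.eq_zero_or_pos s with rfl | hs0
    · rw [zero_add, bwalk_fst_succ, bwalk_zero]
      exact (isStartCorner_startCorner hE).mem_zdArcB
    · have hB := ih hs0 (Nat.le_of_succ_le hstb)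
      have hsP : s < bperiod hE (isOutEdge_startCorner hE) := by omega
      -- the head of the dart at `s` lies on `A ∪ B`; `A` would be a transition
      obtain ⟨-, h2⟩ := hE.arcs_cover_faceBoundary
        (isOutEdge_bwalk (isOutEdge_startCorner hE) s).isFaceBoundaryEdge
      rw [← bwalk_fst_succ] at h2
      rcases h2 with hA | hB'
      · exact (sepDict_no_transition hE htbP htbeq hs0 hsP (by omega) (Or.inr ⟨hB, hA⟩)).elim
      · exact hB'

/-- **The `A`-stretch.** The vertices of the boundary cycle from `e_a` at the positions
`t_b < s ≤ P` (from the `A`-end of `e_b` back to the `A`-end of `e_a`) lie on the arc `A` and are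
joined to the `A`-end `a` of `e_a` by OPEN edges of every completed configuration (the `A`–`A`
boundary edges in between are wired). -/
theorem sepDict_mem_zdArcA_of_lt (hE : E.IsZdAdmissible) (ω : BondConfig (Site 2)) {tb : ℕ}
    (htbP : tb < bperiod hE (isOutEdge_startCorner hE))
    (htbeq : E.bwalk (startCorner hE) tb = ebDart hE) :
    ∀ j, j + tb < bperiod hE (isOutEdge_startCorner hE) →
      (E.bwalk (startCorner hE) (bperiod hE (isOutEdge_startCorner hE) - j)).1 ∈ E.zdArcA ∧
      E.bcBondConfig ω ∈ openConnIn Set.univ (startCorner hE).1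
        (E.bwalk (startCorner hE) (bperiod hE (isOutEdge_startCorner hE) - j)).1 := by
  intro j hj
  induction j with
  | zero =>
    rw [Nat.sub_zero, bwalk_bperiod]
    exact ⟨(isStartCorner_startCorner hE).mem_zdArcA, openConnIn_refl (Set.mem_univ _)⟩
  | succ j ih =>
    obtain ⟨hA, hconn⟩ := ih (by omega)
    set s := bperiod hE (isOutEdge_startCorner hE) - (j + 1) with hs
    have hs1 : bperiod hE (isOutEdge_startCorner hE) - j = s + 1 := by omega
    rw [hs1] at hA hconn
    have hs0 : 0 < s := by omega
    have hsP : s < bperiod hE (isOutEdge_startCorner hE) := by omega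
    have hout := isOutEdge_bwalk (isOutEdge_startCorner hE) s
    obtain ⟨h1, -⟩ := hE.arcs_cover_faceBoundary hout.isFaceBoundaryEdge
    have hA' : (E.bwalk (startCorner hE) s).1 ∈ E.zdArcA := by
      rcases h1 with h1 | hB
      · exact h1
      · exact (sepDict_no_transition hE htbP htbeq hs0 hsP (by omega) (Or.inr ⟨hB, hA⟩)).elim
    refine ⟨hA', ?_⟩
    -- the boundary edge at `s` is an `A`–`A` edge of `Ω_δ`, hence open
    have hopen : cSrc (E.bwalk (startCorner hE) s) ∈ E.bcBondConfig ω := by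
      refine mem_bcBondConfig_of_arcA hout.isFaceBoundaryEdge.1 fun x hx => ?_
      rw [cSrc, Sym2.mem_iff] at hx
      rcases hx with rfl | rfl
      · exact hA'
      · rwa [← bwalk_fst_succ]
    refine PlanarDuality.openConnIn_trans hconn ?_
    rw [openConnIn_comm]
    refine openConnIn_of_adj (Set.mem_univ _) (Set.mem_univ _) (by rwa [bwalk_fst_succ]) ?_
    rw [bwalk_fst_succ]
    exact hout.isFaceBoundaryEdge.1.ne

/-- **A `B`-site of the boundary cycle sits at a position `1 ≤ s ≤ t_b`.** -/
theorem sepDict_idx_of_mem_zdArcB (hE : E.IsZdAdmissible) {tb : ℕ}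
    (htbP : tb < bperiod hE (isOutEdge_startCorner hE))
    (htbeq : E.bwalk (startCorner hE) tb = ebDart hE) {s : ℕ}
    (hsP : s < bperiod hE (isOutEdge_startCorner hE))
    (hB : (E.bwalk (startCorner hE) s).1 ∈ E.zdArcB) : 1 ≤ s ∧ s ≤ tb := by
  constructor
  · by_contra h
    have hs : s = 0 := by omega
    rw [hs, bwalk_zero] at hB
    exact Set.disjoint_left.1 hE.disjoint (isStartCorner_startCorner hE).mem_zdArcA hB
  · by_contra h
    obtain ⟨hA, -⟩ := sepDict_mem_zdArcA_of_lt hE ∅ htbP htbeq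
      (bperiod hE (isOutEdge_startCorner hE) - s) (by omega)
    rw [Nat.sub_sub_self hsP.le] at hA
    exact Set.disjoint_left.1 hE.disjoint hA hB

/-- **An `A`-site of the boundary cycle is wired to the `A`-end of `e_a`** (joined by open edges of
every completed configuration). -/
theorem sepDict_openConnIn_of_mem_zdArcA (hE : E.IsZdAdmissible) (ω : BondConfig (Site 2)) {tb : ℕ}
    (htbP : tb < bperiod hE (isOutEdge_startCorner hE))
    (htbeq : E.bwalk (startCorner hE) tb = ebDart hE) {s : ℕ}
    (hsP : s < bperiod hE (isOutEdge_startCorner hE))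
    (hA : (E.bwalk (startCorner hE) s).1 ∈ E.zdArcA) :
    E.bcBondConfig ω ∈ openConnIn Set.univ (startCorner hE).1 (E.bwalk (startCorner hE) s).1 := by
  rcases Nat.eq_zero_or_pos s with rfl | hs0
  · rw [bwalk_zero]; exact openConnIn_refl (Set.mem_univ _)
  rcases le_or_gt s tb with hle | hlt
  · exact absurd (sepDict_mem_zdArcB_of_le hE htbP htbeq s hs0 hle)
      (Set.disjoint_left.1 hE.disjoint hA)
  · obtain ⟨-, h⟩ := sepDict_mem_zdArcA_of_lt hE ω htbP htbeq
      (bperiod hE (isOutEdge_startCorner hE) - s) (by omega)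
    rwa [Nat.sub_sub_self hsP.le] at h

/-! ### Pendant boundary edges carry one label -/

/-- **An edge of `Ω_δ` bordering no inner face joins sites of the same arc**: an `A`–`B` edge
borders exactly one inner face (admissibility). -/
theorem sepDict_not_AB_of_no_innerFace (hE : E.IsZdAdmissible) {x y : Site 2}
    (hxy : (discreteDomainGraph E.Ω E.δ).Adj x y) (hno : ∀ F, IsCorner x F → ¬ E.IsInnerFace F)
    (hx : x ∈ E.zdArcA ∪ E.zdArcB) (hy : y ∈ E.zdArcA ∪ E.zdArcB) :
    (x ∈ E.zdArcA ∧ y ∈ E.zdArcA) ∨ (x ∈ E.zdArcB ∧ y ∈ E.zdArcB) := by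
  have key : ¬ (s(x, y) ∈ E.zdABEdges) := by
    intro h
    obtain ⟨f, ⟨hf, hfc⟩, -⟩ := hE.zdABEdges_inner _ h
    exact hno f (hfc x (Sym2.mem_mk_left _ _)) hf
  rw [mem_zdABEdges_iff] at key
  rcases hx with hx | hx <;> rcases hy with hy | hy
  · exact Or.inl ⟨hx, hy⟩
  · exact (key ⟨hxy, ⟨x, Sym2.mem_mk_left _ _, hx⟩, ⟨y, Sym2.mem_mk_right _ _, hy⟩⟩).elim
  · exact (key ⟨hxy, ⟨y, Sym2.mem_mk_right _ _, hy⟩, ⟨x, Sym2.mem_mk_left _ _, hx⟩⟩).elim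
  · exact Or.inr ⟨hx, hy⟩

/-! ### Visited edges of the exploration -/

section Visited

/-- The left vertex of the exploration never lies on the dual-wired arc `B`. -/
theorem sepDict_orbit_fst_not_mem_zdArcB (hE : E.IsZdAdmissible) (ω : BondConfig (Site 2)) (n : ℕ) :
    (cornerOrbit (E.bcBondConfig ω) (startCorner hE) n).1 ∉ E.zdArcB := by
  intro hB
  have hA := mem_zdArcA_of_inv hE (cornerOrbit_inv (isStartCorner_startCorner hE) n) (Or.inr hB)
  exact Set.disjoint_left.1 hE.disjoint hA hB

/-- **The exploration visits `e_a` only at its start**: the source edge of every later corner up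
to the exit differs from `e_a`. -/
theorem sepDict_cSrc_cornerOrbit_ne_start (hE : E.IsZdAdmissible) (ω : BondConfig (Site 2)) {n : ℕ}
    (hn1 : 1 ≤ n) (hn : n ≤ exitTime hE ω) :
    cSrc (cornerOrbit (E.bcBondConfig ω) (startCorner hE) n) ≠ cSrc (startCorner hE) := by
  intro h
  have hc₀ := isStartCorner_startCorner hE
  have hA : (cornerOrbit (E.bcBondConfig ω) (startCorner hE) n).1 ∈ E.zdArcA := by
    have hmem : (cornerOrbit (E.bcBondConfig ω) (startCorner hE) n).1 ∈ cSrc (startCorner hE) :=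
      h ▸ Sym2.mem_mk_left _ _
    rw [cSrc, Sym2.mem_iff] at hmem
    rcases hmem with h1 | h1
    · rw [h1]; exact hc₀.mem_zdArcA
    · exact absurd (h1 ▸ hc₀.mem_zdArcB) (sepDict_orbit_fst_not_mem_zdArcB hE ω n)
  have key := eq_of_cSrc_eq_of_arcs hE hA hc₀.mem_zdArcB h
  exact cornerOrbit_ne hE hc₀ (i := 0) (j := n) (by omega)
    (fun k hk => isInnerFace_of_lt_exitTime hE ω (lt_of_lt_of_le hk hn)) (by rw [key]; rfl)

/-- An edge between two inner faces (the `k`-th and `(k+1)`-st around `x`) is not a face-boundary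
edge: it is not the edge of any face-boundary dart. -/
theorem sepDict_cSrc_ne_cTgt_of_inner {x : Site 2} {k : Fin 4} (h1 : E.IsInnerFace (faceAt x k))
    (h2 : E.IsInnerFace (faceAt x (k + 1))) {y : Site 2} {j : Fin 4} (hout : E.IsOutEdge y j) :
    cSrc (y, j) ≠ cTgt (x, k) := by
  intro h
  -- the non-inner face of the dart has both endpoints of the edge as corners
  have hyF : IsCorner y (faceAt y (j + 3)) := isCorner_faceAt y (j + 3)
  have hy'F : IsCorner (y + cornerUnit j) (faceAt y (j + 3)) :=
    (isCorner_add_faceAt_iff y j (j + 3)).2 (Or.inr rfl)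
  have h' : s(y, y + cornerUnit j) = s(x, x + cornerUnit (k + 1)) := h
  have hxF : IsCorner x (faceAt y (j + 3)) ∧ IsCorner (x + cornerUnit (k + 1)) (faceAt y (j + 3)) := by
    rcases Sym2.eq_iff.1 h' with ⟨e1, e2⟩ | ⟨e1, e2⟩
    · exact ⟨e1 ▸ hyF, e2 ▸ hy'F⟩
    · exact ⟨e2 ▸ hy'F, e1 ▸ hyF⟩
  obtain ⟨i, hi⟩ := exists_faceAt_of_isCorner hxF.1
  rw [hi] at hxF
  rcases (isCorner_add_faceAt_iff x (k + 1) i).1 hxF.2 with rfl | rfl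
  · exact hout.2 (by rw [hi]; exact h2)
  · rw [fin4_add_one_add_three] at hi
    exact hout.2 (by rw [hi]; exact h1)

end Visited


/-- **Registered helper `touchExponent_sepDictionary_cycle`** (= `sepDict_openConnIn_of_mem_zdArcA`):
an `A`-site of the boundary cycle from `e_a` is wired to the `A`-end of `e_a` in every completed
configuration. -/
theorem touchExponent_sepDictionary_cycle : ∀ (E : DiscreteDobrushin) (hE : E.IsZdAdmissible) (ω : BondConfig (Site 2)) (tb s : ℕ), tb < DiscreteDobrushin.bperiod hE (DiscreteDobrushin.isOutEdge_startCorner hE) → E.bwalk (DiscreteDobrushin.startCorner hE) tb = DiscreteDobrushin.ebDart hE → s < DiscreteDobrushin.bperiod hE (DiscreteDobrushin.isOutEdge_startCorner hE) → (E.bwalk (DiscreteDobrushin.startCorner hE) s).1 ∈ E.zdArcA → E.bcBondConfig ω ∈ openConnIn Set.univ (DiscreteDobrushin.startCorner hE).1 (E.bwalk (DiscreteDobrushin.startCorner hE) s).1 :=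
  fun _ hE ω _ _ htbP htbeq hsP hA => sepDict_openConnIn_of_mem_zdArcA hE ω htbP htbeq hsP hA

end Summit.CriticalPhenomena.CardyFormulaZ2.Theorems.SymmetryUpgradeR.SwallowingSkeleton

end
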